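import Literature.Geometry.Riemannian.MetricFlowFDistanceRestrict
import Literature.Geometry.Riemannian.WassersteinW1Triangle
import HarnessLib

/-!
# Extending a correspondence between restricted flows to the whole time set; a diagonal lemma
# (tools for Bamler 2023, §6.2, Thm. 6.5)

R. Bamler, *Compactness theory of the space of super Ricci flows*, Invent. Math. 233 (2023), §6.2,
proof of Thm. 6.5 (arXiv v1 Thm. 129, convergence on compact time-intervals): correspondences
between the RESTRICTIONS `𝒳ⁱ_{I₀ⁱ}`, `𝒳^∞_{I₀ⁱ}` of the flows to windows `I₀ⁱ ↑ I^∞`, chosen by a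
diagonal argument (`k_i → ∞`), are combined "as in the previous proof" (Thm. 6.4) into one
correspondence between the unrestricted flows. This file supplies the two formal tools this needs
on top of `MetricFlowFDistanceRestrict.lean` (restriction) and the wedge of
`MetricFlowFConvergenceWithinExists.lean`:

* `MetricFlow.Correspondence₂.extend` — a correspondence `𝔇` between the restricted flows
  `𝒳¹|_{I₁'}`, `𝒳²|_{I₂'}` over a window `I_w` read as a correspondence between `𝒳¹`, `𝒳²` over any
  `I'' ⊇ I_w`: the same domains and embeddings, comparison spaces `ExtendSpace 𝔇 t = Σ (h : t ∈ I_w), Z^𝔇_t`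
  (empty outside the window; `Metric.Sigma.metricSpace`), with `kernelDistWithin_extend_le` (the integrand
  of the extension is at most that of `𝔇`) and `fDistWithin_restrictPair_extend_le`: restricting the
  extension back to a measurable sub-window `W ⊆ I_w` costs nothing,
  `d^{(𝔇.extend)|_W, J ∩ W}_𝔽 ≤ d^{𝔇, J ∩ I_w}_𝔽` (exceptional set `E ∩ W`, the same couplings);
* `MetricFlow.Correspondence₂.restrictPair` — the restriction of a correspondence between the flows
  of two metric flow PAIRS to a window, in the normal form used by `fDistWithin_restrict_le`;
* `exists_diagonal_of_eventually` — the diagonal choice: if `p k n` holds for all large `n` (each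
  `k`), there is `κ : ℕ → ℕ` with `κ n → ∞` and `p (κ n) n` for all large `n`.

Everything is proved; the only definitions are `ExtendSpace` (+ `mk`), `extend` and `restrictPair`.

## References

* R. H. Bamler, *Compactness theory of the space of super Ricci flows*, Invent. Math. 233 (2023),
  1121–1277 (arXiv:2008.09298), §5.1 Def. 5.5; §6.1 Def. 6.1, Remark 6.2; §6.2, Thm. 6.5 (arXiv
  v1 Thm. 129) and its proof. [Bamler2023]
-/

noncomputable section

open Set MeasureTheory Filter TopologicalSpace Function
open scoped Topology ENNReal NNReal

namespace Literature.Geometry.Riemannian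

universe u

/-! ### The diagonal lemma -/

/-- **Diagonal choice**: if for every `k` the property `p k n` holds for all large `n`, then there
is a sequence `κ n → ∞` with `p (κ n) n` for all large `n` (the choice "`k_i → ∞` such that for
large `i` …" in Bamler 2023, §6.2, proof of Thm. 6.5: with thresholds `N k` and
`M k := max_{j ≤ k} N j`, take `κ n :=` the largest `k ≤ n` with `M k ≤ n`). [folklore] -/
theorem exists_diagonal_of_eventually {p : ℕ → ℕ → Prop} (h : ∀ k, ∀ᶠ n in atTop, p k n) :
    ∃ κ : ℕ → ℕ, Tendsto κ atTop atTop ∧ ∀ᶠ n in atTop, p (κ n) n := by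
  classical
  choose N hN using fun k ↦ eventually_atTop.1 (h k)
  set M : ℕ → ℕ := fun k ↦ (Finset.range (k + 1)).sup N with hM
  have hNM : ∀ k, N k ≤ M k := fun k ↦ Finset.le_sup (f := N) (Finset.self_mem_range_succ k)
  set κ : ℕ → ℕ := fun n ↦ Nat.findGreatest (fun k ↦ M k ≤ n) n with hκ
  refine ⟨κ, tendsto_atTop_atTop.2 fun K₀ ↦ ⟨max K₀ (M K₀), fun n hn ↦ ?_⟩, ?_⟩
  · exact Nat.le_findGreatest ((le_max_left _ _).trans hn) ((le_max_right _ _).trans hn)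
  · refine eventually_atTop.2 ⟨M 0, fun n hn ↦ ?_⟩
    have hspec : M (κ n) ≤ n := Nat.findGreatest_spec (P := fun k ↦ M k ≤ n) (Nat.zero_le n) hn
    exact hN (κ n) n ((hNM _).trans hspec)

namespace MetricFlow

namespace Correspondence₂

/-! ### Restriction in normal form, and extension from a window -/

/-- **The restriction of a correspondence between the flows of two metric flow pairs to a window
`W`** (`W ⊆ I''`, `W ⊆ I₁`, `W ⊆ I₂`), as a correspondence between the flows of the restricted pairs
`P₁|_W`, `P₂|_W` over `W` — `Correspondence₂.restrict` in the normal form of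
`MetricFlowPair.fDistWithin_restrict_le` (Bamler 2023, §6.1: `ℭ|_{I'' ∩ I₀}`).
[cite: Bamler2023, §6.1, Def. 6.1] -/
abbrev restrictPair {I₁ I₂ I'' : Set ℝ} {P₁ : MetricFlowPair.{u} I₁} {P₂ : MetricFlowPair.{u} I₂}
    (ℭ : Correspondence₂ P₁.flow P₂.flow I'') {W : Set ℝ} (hW : W ⊆ I'') (hW₁ : W ⊆ I₁)
    (hW₂ : W ⊆ I₂) : Correspondence₂ (P₁.restrict hW₁).flow (P₂.restrict hW₂).flow W :=
  ℭ.restrict (I₁' := P₁.I' ∩ W) (I₂' := P₂.I' ∩ W) hW inter_subset_left inter_subset_left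
    (fun _ ht ↦ ⟨(ℭ.dom₁_subset ht.1).1, ht.2⟩) (fun _ ht ↦ ⟨(ℭ.dom₂_subset ht.1).1, ht.2⟩)

variable {I₀ Iw : Set ℝ} {P₁ P₂ : MetricFlowPair.{u} I₀} {hw : Iw ⊆ I₀}

/-- The comparison spaces of the extension `𝔇.extend`: `Σ (h : t ∈ I_w), Z^𝔇_t` — a copy of
`Z^𝔇_t` for `t ∈ I_w`, empty otherwise. [cite: Bamler2023, §6.2, proof of Thm. 6.5] -/
def ExtendSpace (𝔇 : Correspondence₂ (P₁.restrict hw).flow (P₂.restrict hw).flow Iw) (t : I₀) :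
    Type u :=
  Σ h : PLift ((t : ℝ) ∈ Iw), 𝔇.Z ⟨t, h.down⟩

namespace ExtendSpace

variable {𝔇 : Correspondence₂ (P₁.restrict hw).flow (P₂.restrict hw).flow Iw} {t : I₀}

/-- The sum metric (`Metric.Sigma.metricSpace`; there is at most one summand).
[cite: Bamler2023, §6.2, proof of Thm. 6.5] -/
instance instMetricSpace : MetricSpace (ExtendSpace 𝔇 t) := Metric.Sigma.metricSpace

/-- The Borel σ-algebra. [cite: Bamler2023, §6.2, proof of Thm. 6.5] -/
instance instMeasurableSpace : MeasurableSpace (ExtendSpace 𝔇 t) := borel _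

/-- The Borel σ-algebra. [cite: Bamler2023, §6.2, proof of Thm. 6.5] -/
instance instBorelSpace : BorelSpace (ExtendSpace 𝔇 t) := ⟨rfl⟩

/-- The inclusion of `Z^𝔇_t` (`t ∈ I_w`). [cite: Bamler2023, §6.2, proof of Thm. 6.5] -/
protected def mk (h : (t : ℝ) ∈ Iw) (z : 𝔇.Z ⟨t, h⟩) : ExtendSpace 𝔇 t := ⟨⟨h⟩, z⟩

/-- The inclusion of `Z^𝔇_t` is an isometry. [cite: Bamler2023, §6.2, proof of Thm. 6.5] -/
theorem isometry_mk (h : (t : ℝ) ∈ Iw) : Isometry (ExtendSpace.mk (𝔇 := 𝔇) (t := t) h) :=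
  Metric.Sigma.isometry_mk (E := fun h' : PLift ((t : ℝ) ∈ Iw) ↦ 𝔇.Z ⟨t, h'.down⟩) ⟨h⟩

/-- The inclusion of `Z^𝔇_t` is measurable. [cite: Bamler2023, §6.2, proof of Thm. 6.5] -/
theorem measurable_mk (h : (t : ℝ) ∈ Iw) : Measurable (ExtendSpace.mk (𝔇 := 𝔇) (t := t) h) :=
  (isometry_mk h).continuous.measurable

end ExtendSpace

/-- **Extension of a correspondence between the restricted pairs `P₁|_{I_w}`, `P₂|_{I_w}` over a
window `I_w ⊆ I₀` to a correspondence between the unrestricted flows over `I₀`** (the step "these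
are correspondences over the window only; read them as correspondences over `I^∞`" implicit in
Bamler 2023, §6.2, proof of Thm. 6.5, cf. Remark 6.2): the same domains `I''^{,i} ⊆ I_w` and
embeddings, comparison spaces `ExtendSpace 𝔇 t = Σ (h : t ∈ I_w), Z^𝔇_t`.
[cite: Bamler2023, §6.2, proof of Thm. 6.5 (arXiv v1 Thm. 129); §6.1, Remark 6.2] -/
def extend (hw : Iw ⊆ I₀) (𝔇 : Correspondence₂ (P₁.restrict hw).flow (P₂.restrict hw).flow Iw) :
    Correspondence₂ P₁.flow P₂.flow I₀ where
  Z := ExtendSpace 𝔇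
  dom₁ := 𝔇.dom₁
  dom₂ := 𝔇.dom₂
  dom₁_subset := fun _ ht ↦ ⟨(𝔇.dom₁_subset ht).1.1, hw (𝔇.dom₁_subset ht).2⟩
  dom₂_subset := fun _ ht ↦ ⟨(𝔇.dom₂_subset ht).1.1, hw (𝔇.dom₂_subset ht).2⟩
  φ₁ := fun t ht x ↦ ExtendSpace.mk (𝔇.dom₁_subset ht).2 (𝔇.φ₁ t ht x)
  φ₂ := fun t ht x ↦ ExtendSpace.mk (𝔇.dom₂_subset ht).2 (𝔇.φ₂ t ht x)
  isometry₁ := fun t ht ↦ (ExtendSpace.isometry_mk _).comp (𝔇.isometry₁ t ht)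
  isometry₂ := fun t ht ↦ (ExtendSpace.isometry_mk _).comp (𝔇.isometry₂ t ht)

/-- The domains of the extension are those of `𝔇`. [cite: Bamler2023, §6.2, proof of Thm. 6.5] -/
@[simp] theorem extend_dom₁ (hw : Iw ⊆ I₀)
    (𝔇 : Correspondence₂ (P₁.restrict hw).flow (P₂.restrict hw).flow Iw) :
    (𝔇.extend hw).dom₁ = 𝔇.dom₁ := rfl

/-- The domains of the extension are those of `𝔇`. [cite: Bamler2023, §6.2, proof of Thm. 6.5] -/
@[simp] theorem extend_dom₂ (hw : Iw ⊆ I₀)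
    (𝔇 : Correspondence₂ (P₁.restrict hw).flow (P₂.restrict hw).flow Iw) :
    (𝔇.extend hw).dom₂ = 𝔇.dom₂ := rfl

end Correspondence₂

end MetricFlow

namespace MetricFlowPair

open MetricFlow

/-! ### The extension is not worse than the window correspondence -/

/-- **The integrand of the extension is at most that of `𝔇`** (in fact equal): both push-forwards
factor through the isometric embedding `Z^𝔇_s → Σ_h Z^𝔇_s` (`wassersteinW1_map_le_of_edist_le`).
[cite: Bamler2023, §6.2, proof of Thm. 6.5 (arXiv v1 Thm. 129)] -/
theorem kernelDistWithin_extend_le {I₀ Iw : Set ℝ} {P₁ P₂ : MetricFlowPair.{u} I₀} (hw : Iw ⊆ I₀)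
    (𝔇 : Correspondence₂ (P₁.restrict hw).flow (P₂.restrict hw).flow Iw) {s t : ℝ}
    (hs₁ : s ∈ 𝔇.dom₁) (hs₂ : s ∈ 𝔇.dom₂) (ht₁ : t ∈ 𝔇.dom₁) (ht₂ : t ∈ 𝔇.dom₂)
    (p : P₁.flow.Slice ⟨t, ((𝔇.extend hw).dom₁_subset ht₁).1⟩ ×
      P₂.flow.Slice ⟨t, ((𝔇.extend hw).dom₂_subset ht₂).1⟩) :
    kernelDistWithin P₁ P₂ (𝔇.extend hw) hs₁ hs₂ ht₁ ht₂ p ≤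
      kernelDistWithin (P₁.restrict hw) (P₂.restrict hw) 𝔇 hs₁ hs₂ ht₁ ht₂ p := by
  set M := Correspondence₂.ExtendSpace.mk (𝔇 := 𝔇) (t := ⟨s, hw (𝔇.dom₁_subset hs₁).2⟩)
    (𝔇.dom₁_subset hs₁).2 with hMdef
  have hM : Isometry M := Correspondence₂.ExtendSpace.isometry_mk _
  have hMm : Measurable M := hM.continuous.measurable
  have hφ₁m : Measurable (𝔇.φ₁ s hs₁) := (𝔇.isometry₁ s hs₁).continuous.measurable
  have hφ₂m : Measurable (𝔇.φ₂ s hs₂) := (𝔇.isometry₂ s hs₂).continuous.measurable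
  -- everything typed over the restricted flows (definitionally the original slices and kernels)
  have key : wassersteinW1
      ((((P₁.restrict hw).flow.condKernel (t := ⟨t, (𝔇.dom₁_subset ht₁).1⟩) p.1
        ⟨s, (𝔇.dom₁_subset hs₁).1⟩).map (𝔇.φ₁ s hs₁)).map M)
      ((((P₂.restrict hw).flow.condKernel (t := ⟨t, (𝔇.dom₂_subset ht₂).1⟩) p.2
        ⟨s, (𝔇.dom₂_subset hs₂).1⟩).map (𝔇.φ₂ s hs₂)).map M) ≤
      wassersteinW1
        (((P₁.restrict hw).flow.condKernel (t := ⟨t, (𝔇.dom₁_subset ht₁).1⟩) p.1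
          ⟨s, (𝔇.dom₁_subset hs₁).1⟩).map (𝔇.φ₁ s hs₁))
        (((P₂.restrict hw).flow.condKernel (t := ⟨t, (𝔇.dom₂_subset ht₂).1⟩) p.2
          ⟨s, (𝔇.dom₂_subset hs₂).1⟩).map (𝔇.φ₂ s hs₂)) :=
    wassersteinW1_map_le_of_edist_le hMm (fun x y ↦ (hM.edist_eq x y).le) _ _
  rw [Measure.map_map hMm hφ₁m, Measure.map_map hMm hφ₂m] at key
  exact key

/-- **Restricting the extension back to a measurable sub-window `W ⊆ I_w` costs nothing**:
every radius admissible for `𝔇` (uniform over `J ∩ I_w`) is admissible for `(𝔇.extend)|_W`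
uniform over `J ∩ W` — exceptional set `E ∩ W`, the same couplings, the integrand being pointwise
smaller (`kernelDistWithin_extend_le`). Hence
`d^{(𝔇.extend)|_W, J ∩ W}_𝔽(P₁|_W, P₂|_W) ≤ d^{𝔇, J ∩ I_w}_𝔽(P₁|_{I_w}, P₂|_{I_w})`.
[cite: Bamler2023, §6.2, proof of Thm. 6.5 (arXiv v1 Thm. 129); §6.1, Def. 6.1] -/
theorem fDistWithin_restrictPair_extend_le {I₀ Iw W : Set ℝ} {P₁ P₂ : MetricFlowPair.{u} I₀}
    (hw : Iw ⊆ I₀) (𝔇 : Correspondence₂ (P₁.restrict hw).flow (P₂.restrict hw).flow Iw)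
    (hWw : W ⊆ Iw) (hWm : MeasurableSet W) (hW : W ⊆ I₀) (J : Set ℝ) :
    fDistWithin (P₁.restrict hW) (P₂.restrict hW) ((𝔇.extend hw).restrictPair hW hW hW) (J ∩ W) ≤
      fDistWithin (P₁.restrict hw) (P₂.restrict hw) 𝔇 (J ∩ Iw) := by
  refine le_fDistWithin_iff.2 fun r hr ↦ fDistWithin_le ?_
  obtain ⟨hr, E, hEm, hEI, hJ, hE₁, hE₂, hvol, q, hq, hint⟩ := hr
  have hsub : ∀ {t : ℝ}, t ∈ W \ (E ∩ W) → t ∈ Iw \ E :=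
    fun {t} ht ↦ ⟨hWw ht.1, fun hE ↦ ht.2 ⟨hE, ht.1⟩⟩
  refine ⟨hr, E ∩ W, hEm.inter hWm, inter_subset_right, ?_, ?_, ?_, ?_, fun t ht ↦ q t (hsub ht),
    fun t ht ↦ hq t (hsub ht), fun s hs t ht hst ↦ ?_⟩
  · exact fun t ht ↦ ⟨ht.2, fun hE ↦ (hJ ⟨ht.1, hWw ht.2⟩).2 hE.1⟩
  · exact fun t ht ↦ ⟨hE₁ (hsub ht), ht.1⟩
  · exact fun t ht ↦ ⟨hE₂ (hsub ht), ht.1⟩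
  · exact (measure_mono inter_subset_left).trans hvol
  · exact (lintegral_mono fun p ↦ kernelDistWithin_extend_le hw 𝔇 (hE₁ (hsub hs)) (hE₂ (hsub hs))
      (hE₁ (hsub ht)) (hE₂ (hsub ht)) p).trans (hint s (hsub hs) t (hsub ht) hst)

end MetricFlowPair

end Literature.Geometry.Riemannian

end
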